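import Literature.NumberTheory.LFunctions.HeckeLandauPageLowerBound

/-!
# Route `PrimeLevelFamEdge` — TYPED IDEA DELTAS, deck 7: RESOLUTION (card K6-11 «W-RES — the door's
# output lies below the Page resolution»; cell ls-idea, seat ls-idea-lens-6 gen 4, sketch #7
`Sketch_WRES.lean`; critics A PASS as NO-GO/LEDGER LAW at elementary-rigorous grade · B adopted as
BN-18 «W-RES» · C PASS ≤ NC)

The card: door U-d concludes from `K_A ∧ K_B` at ONE compatible prime level `q` (off-diagonal length
`x ≍ q^{1+λ}`) a bound `κ·(log x)^{−s} ≤ L(1,χ_D)` with `s = 2a + b > 1` in every regime it runs in;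
every CHARACTER-SEPARATING producer of `K_A` delivers it in Page two-branch form, of which the door can
use only branch (N) «no real zero of `L(s,χ_D)` in `[1 − θ(q), 1)`», `θ(q) ≥ C/log x` forced by honesty
— and (N) ALONE already gives `L(1,χ_D) ≥ c₂θ(q) ≥ c₂C/log x` (Hecke–Landau–Page), which DOMINATES the
door's output. Hence the least ADMISSIBLE form of `K_A/K_B` is BRANCH-FREE — which the route's own
typed K_A `KMV2000.MomentAsymptotics 1 Δ T₁ T₂` IS (W-RES confirms the typing and prices only the
cell's two-branch relaxations). Typed here: `BranchN` (what branch (N) asserts), the KERNEL link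
`branchN_lowerBound` (branch (N) ⇒ `c₂θ ≤ ‖L(1,χ_D)‖`, HYPOTHESIS-FREE through the tree's PROVED
`heckeLandauPageLB_scale`, Literature `HeckeLandauPageLowerBound.lean`), and the two domination
inequalities (the sketch's, proved). «typed ≠ proved for the card's regime claims (`s > 1`,
`θ ≥ C/log x`); no exceptional-zero theorem (no Landau–Siegel exclusion, no Theorem 1–2 of
arXiv:2211.02515, no repaired Margin232) is proved by ideation». Filed `--supports stmt-Parity-20007
--as helper`.
-/

noncomputable section

namespace Summit.Parity.GeneralizedHardyLittlewood.Theorems.PrimeLevelFamEdgeIdeaDeltas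

open Literature.NumberTheory.LFunctions

/-- **K6-11: branch (N) content for `χ`** of an honest two-branch mollified-moment theorem at a level
whose off-diagonal sums have length `x` (`MomentAsymptoticsTwoBranch` / K4-5 / K-I8-7 shapes;
`θ = θ(q) ≥ C/log x`): no real zero of `L(s, χ)` in `[1 − θ, 1)`. A PREDICATE in `(θ, χ)`; nothing
asserted. [cite: MontgomeryVaughan2007, Thm. 11.4 (11.7)] -/
def BranchN (θ : ℝ) (D : ℕ) [NeZero D] (χ : DirichletCharacter ℂ D) : Prop :=
  ∀ σ : ℝ, 1 - θ ≤ σ → σ < 1 → χ.LFunction σ ≠ 0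

/-- **K6-11 (kernel, hypothesis-free): branch (N) ALONE already yields `c₂·θ ≤ ‖L(1,χ)‖`** for every
nonprincipal `χ mod D`, `D ≥ 3`, `0 < θ ≤ η₀/log D` — with `c₂ = c₂(η₀) > 0` from the tree's PROVED
Hecke–Landau–Page resolution form `heckeLandauPageLB_scale` (no named fact involved).
[cite: MontgomeryVaughan2007, Thm. 11.4 (11.7) and (11.10)] -/
theorem branchN_lowerBound {η₀ : ℝ} (hη : 0 < η₀) :
    ∃ c₂ : ℝ, 0 < c₂ ∧ ∀ (D : ℕ) [NeZero D] (χ : DirichletCharacter ℂ D), 3 ≤ D → χ ≠ 1 →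
      ∀ θ : ℝ, 0 < θ → θ * Real.log D ≤ η₀ → BranchN θ D χ → c₂ * θ ≤ ‖χ.LFunction 1‖ :=
  heckeLandauPageLB_scale hη

/-- **K6-11, the DOMINATION inequality (proved, the sketch's).** For `s > 1` (`s = 2a + b`) and
`κ, c₂, C > 0`: whenever `0 < log x` and `log x ≥ (κ/(c₂ C))^{1/(s−1)}`, the door's output
`κ (log x)^{−s}` is at most branch (N)'s free consequence `c₂ C/log x` (`θ(q) ≥ C/log x`). Pure real
analysis. [cite: MontgomeryVaughan2007, Thm. 11.4 (11.7)] -/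
theorem door_output_dominated {s κ c₂ C x : ℝ} (hs : 1 < s) (hκ : 0 < κ) (hc : 0 < c₂)
    (hC : 0 < C) (hL0 : 0 < Real.log x) (hL2 : (κ / (c₂ * C)) ^ (s - 1)⁻¹ ≤ Real.log x) :
    κ * Real.log x ^ (-s) ≤ c₂ * C / Real.log x := by
  set L := Real.log x with hLdef
  have hcC : 0 < c₂ * C := mul_pos hc hC
  have hr : 0 ≤ κ / (c₂ * C) := le_of_lt (div_pos hκ hcC)
  have hs1 : s - 1 ≠ 0 := by linarith
  have hpow : κ / (c₂ * C) ≤ L ^ (s - 1) := by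
    have := Real.rpow_le_rpow (Real.rpow_nonneg hr _) hL2 (le_of_lt (by linarith : (0:ℝ) < s - 1))
    rwa [Real.rpow_inv_rpow hr hs1] at this
  have hLs1 : 0 < L ^ (s - 1) := Real.rpow_pos_of_pos hL0 _
  have hsplit : L ^ (-s) = (L ^ (s - 1))⁻¹ * L⁻¹ := by
    rw [show -s = -(s - 1) + (-1) by ring, Real.rpow_add hL0, Real.rpow_neg hL0.le,
      Real.rpow_neg_one]
  have hk : κ * (L ^ (s - 1))⁻¹ ≤ c₂ * C := by
    rw [← div_eq_mul_inv, div_le_iff₀ hLs1]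
    have := (div_le_iff₀ hcC).1 hpow
    linarith [this]
  calc κ * L ^ (-s) = κ * (L ^ (s - 1))⁻¹ * L⁻¹ := by rw [hsplit]; ring
    _ ≤ c₂ * C * L⁻¹ := mul_le_mul_of_nonneg_right hk (le_of_lt (inv_pos.2 hL0))
    _ = c₂ * C / L := by rw [div_eq_mul_inv]

/-- **K6-11, domination in the SLIVER's form (proved):** branch (N) there has
`θ(q) ≍ C log log x/log x`; for `log x ≥ e` this only helps (`log log x ≥ 1`).
[cite: MontgomeryVaughan2007, Thm. 11.4 (11.7)] -/
theorem door_output_dominated_loglog {s κ c₂ C x : ℝ} (hs : 1 < s) (hκ : 0 < κ) (hc : 0 < c₂)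
    (hC : 0 < C) (hL1 : Real.exp 1 ≤ Real.log x)
    (hL2 : (κ / (c₂ * C)) ^ (s - 1)⁻¹ ≤ Real.log x) :
    κ * Real.log x ^ (-s) ≤ c₂ * C * Real.log (Real.log x) / Real.log x := by
  have hL0 : 0 < Real.log x := lt_of_lt_of_le (Real.exp_pos 1) hL1
  have hLL : 1 ≤ Real.log (Real.log x) := by
    rw [Real.le_log_iff_exp_le hL0]; exact hL1
  have h := door_output_dominated hs hκ hc hC hL0 hL2
  calc κ * Real.log x ^ (-s) ≤ c₂ * C / Real.log x := h
    _ = c₂ * C * 1 / Real.log x := by ring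
    _ ≤ c₂ * C * Real.log (Real.log x) / Real.log x := by
        apply div_le_div_of_nonneg_right _ hL0.le
        exact mul_le_mul_of_nonneg_left hLL (le_of_lt (mul_pos hc hC))

end Summit.Parity.GeneralizedHardyLittlewood.Theorems.PrimeLevelFamEdgeIdeaDeltas
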